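import Mathlib
import Literature.Analysis.FluidPDE.VectorCalculus
import Literature.Analysis.FluidPDE.VorticityCalculus
import Literature.Analysis.FluidPDE.BiotSavartNewtonKernel
import Literature.Analysis.FluidPDE.BiotSavartCurlPair
import Literature.Analysis.FluidPDE.AxisymGradientField
import Literature.Analysis.PDE.LoewnerNirenbergKelvin
import Summits.NavierStokesRegularity.NavierStokesRegularity.Theorems.ThreadingFluxCentreJetDefs
import Summits.NavierStokesRegularity.NavierStokesRegularity.Theorems.LandauTailHomSteadyProfileExistsCalculus
import Summits.NavierStokesRegularity.NavierStokesRegularity.Theorems.TypeIQuarterGateScarEnvelopeTypeIForcedTsaiStokesletSelfAdvection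
import Summits.NavierStokesRegularity.NavierStokesRegularity.Theorems.ThreadingFluxHorizonTowerProfileCurlT1
import Summits.NavierStokesRegularity.NavierStokesRegularity.Theorems.ThreadingFluxAzimuthalCartanLocalCurlCurl
import Summits.NavierStokesRegularity.NavierStokesRegularity.Theorems.ThreadingFluxAzimuthalCartanVertexWitnessDefs
import Summits.NavierStokesRegularity.NavierStokesRegularity.Theorems.ThreadingFluxAzimuthalCartanVertexWitnessGradient
import Summits.NavierStokesRegularity.NavierStokesRegularity.Theorems.ThreadingFluxAzimuthalCartanVertexWitnessLaplacian
import Literature.Analysis.FluidPDE.LandauSolutions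
import Literature.Analysis.FluidPDE.SverakLandauClassification
import Summits.NavierStokesRegularity.NavierStokesRegularity.Theorems.ThreadingFluxAzimuthalCartanDefs
import Summits.NavierStokesRegularity.NavierStokesRegularity.Theorems.ThreadingFluxAzimuthalCartanLandauBaseTools
import Summits.NavierStokesRegularity.NavierStokesRegularity.Theorems.ThreadingFluxAzimuthalCartanVertexWitnessMomentumA
import HarnessLib

/-!
# Crux `PoloidalLiouville` (stmt-NavierStokesRegularity-1222, W1), «azimuthal-cartan-test» (V26), V♯ `LandauVertexFlexibility`:
# momentum computation II — ★★★ the linearised momentum identity for the explicit witness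

★★★ `momentum_witness` — off the axis ray, `Dδv(x)(U x) + DU(x)(δv x) + ∇δp(x) = Δδv(x)` for Landau's flow `U = landau2` (`c = 2`,
axis `e₂`) and the explicit pair `(δvf, δpf)` of `…VertexWitnessDefs`.  Ingredients: `laplacian_witness` (Δδv = −curl w), the Hessian–vector
products of θ through the `c`-normal form, the tree's `fderiv_landauAxisField_apply` / `LandauBase.fderiv_landauAxisPressure_apply` /
`fderiv_landauBeta_apply`, the pressure normal form `deltap_eq_Fp` (`fderiv_Phi_apply`), then per component `field_simp` and a
`linear_combination` of `|x|² = x₀² + x₁² + x₂²` with an explicit multiplier (24 / 24 / 18 monomials, computed by the exact engine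
`kb/lc_multiplier.py` from Lean's own residual).  Farm-verified as the self-contained twin `probes/LapDev7.lean` (rc 0, 0 sorries).
The sequel `…VertexWitnessFlexibility.lean` assembles V♯.  `--supports stmt-NavierStokesRegularity-1222 --as helper`; 0 kit. [folklore]
-/

-- the summit and its single problem share the name (D-0017 nested layout)
set_option linter.dupNamespace false

noncomputable section

open Set Function Metric Filter
open scoped RealInnerProductSpace Topology Laplacian InnerProductSpace
open Literature.Analysis.FluidPDE
open Literature.Analysis.PDE.LoewnerNirenberg

namespace Summit.NavierStokesRegularity.NavierStokesRegularity.Theorems.PoloidalLiouville.AzimuthalCartan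

open Summit.NavierStokesRegularity.NavierStokesRegularity.Theorems
open Summit.NavierStokesRegularity.NavierStokesRegularity.Theorems.PoloidalLiouville.CentreJet (E3)
open Summit.NavierStokesRegularity.NavierStokesRegularity.Theorems.LandauTail
open Summit.NavierStokesRegularity.NavierStokesRegularity.Cruxes.ScarEnvelopeTypeI.ForcedTsai
  (curl_gradient_eq_zero_of_contDiffAt curl_id_eq_zero)
open Summit.NavierStokesRegularity.NavierStokesRegularity.Theorems.PoloidalLiouville.HorizonTower (inner_cross_self_right)

namespace VertexWitness

/-- `DΦ(y)v = q₂(y)v₂ + q₃(y)⟪v, y⟫` off the ray (`Φ = log(3r²/(2r − x₂)²)`). [folklore] -/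
theorem fderiv_Phi_apply {y : E3} (hy : ‖y‖ ≠ y 2) (v : E3) :
    fderiv ℝ Φf y v = q2 y * v 2 + q3 y * ⟪v, y⟫ := by
  obtain ⟨h0, h1, h2⟩ : y ≠ 0 ∧ ‖y‖ - y 2 ≠ 0 ∧ 2 * ‖y‖ - y 2 ≠ 0 := by
    have hle' : y 2 ≤ ‖y‖ := (le_abs_self _).trans (by simpa using PiLp.norm_apply_le y 2)
    refine ⟨fun h => hy ?_, sub_ne_zero.2 hy, ?_⟩
    · rw [h]; simp
    · intro h
      have : ‖y‖ = 0 := by linarith [norm_nonneg y]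
      rw [norm_eq_zero] at this
      apply hy; rw [this]; simp
  have hr0 : ‖y‖ ≠ 0 := norm_ne_zero_iff.2 h0
  have hn : HasFDerivAt (fun z : E3 => ‖z‖) (‖y‖⁻¹ • (innerSL ℝ y : E3 →L[ℝ] ℝ)) y := hasFDerivAt_norm_of_ne_zero h0
  have hp2 : HasFDerivAt (fun z : E3 => z 2) (EuclideanSpace.proj 2 : E3 →L[ℝ] ℝ) y :=
    (EuclideanSpace.proj (2 : Fin 3) : E3 →L[ℝ] ℝ).hasFDerivAt
  have hnsq : HasFDerivAt (fun z : E3 => ‖z‖ ^ 2) _ y :=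
    (hn.mul hn).congr_of_eventuallyEq (Filter.Eventually.of_forall fun z => (sq ‖z‖))
  have hD2 : HasFDerivAt (fun z : E3 => 2 * ‖z‖ - z 2) _ y := (hn.const_mul 2).sub hp2
  have hD2sq : HasFDerivAt (fun z : E3 => (2 * ‖z‖ - z 2) ^ 2) _ y :=
    (hD2.mul hD2).congr_of_eventuallyEq (Filter.Eventually.of_forall fun z => (sq (2 * ‖z‖ - z 2)))
  have hm2inv : HasFDerivAt (fun z : E3 => ((2 * ‖z‖ - z 2) ^ 2)⁻¹) _ y :=
    (hasDerivAt_inv (pow_ne_zero 2 h2)).comp_hasFDerivAt y hD2sq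
  have hf : HasFDerivAt (fun z : E3 => 3 * ‖z‖ ^ 2 / (2 * ‖z‖ - z 2) ^ 2) _ y := (hnsq.const_mul 3).mul hm2inv
  have hfpos : 3 * ‖y‖ ^ 2 / (2 * ‖y‖ - y 2) ^ 2 ≠ 0 := by positivity
  have hΦ : HasFDerivAt Φf _ y := hf.log hfpos
  rw [hΦ.fderiv]
  have hpj : ∀ (i : Fin 3) (v : E3), (EuclideanSpace.proj i : E3 →L[ℝ] ℝ) v = v i := fun i v => rfl
  simp only [add_apply, smul_apply, sub_apply, smul_eq_mul, innerSL_apply_apply, hpj, q2, q3, real_inner_comm y v]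
  have h2' : ‖y‖ * 2 - y 2 ≠ 0 := fun h => h2 (by linarith)
  field_simp
  ring

/-- The witness pressure in local normal form off the ray: `δp = Fp`. [folklore] -/
theorem deltap_eq_Fp {y : E3} (hy : ‖y‖ ≠ y 2) : δpf y = Fp y := by
  have hgθ : ∀ i : Fin 3, gradient θf y i = fderiv ℝ θf y (EuclideanSpace.single i 1) := fun i =>
    gradient_apply_eq_fderiv_single θf y i
  have hgΦ : ∀ i : Fin 3, gradient Φf y i = fderiv ℝ Φf y (EuclideanSpace.single i 1) := fun i =>
    gradient_apply_eq_fderiv_single Φf y i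
  have i0 : ⟪(EuclideanSpace.single 0 1 : E3), y⟫ = y 0 := by rw [EuclideanSpace.inner_single_left]; simp
  have i1 : ⟪(EuclideanSpace.single 1 1 : E3), y⟫ = y 1 := by rw [EuclideanSpace.inner_single_left]; simp
  have i2 : ⟪(EuclideanSpace.single 2 1 : E3), y⟫ = y 2 := by rw [EuclideanSpace.inner_single_left]; simp
  have hθL : ∀ v : E3, fderiv ℝ θf y v = c0 y * v 0 + c1 y * v 1 + c2 y * v 2 + c3 y * ⟪v, y⟫ := fun v => by
    rw [show fderiv ℝ θf y = Lθ y from fderiv_theta_eq_L hy, Ltheta_apply]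
  simp only [δpf, Fp, gf, PiLp.inner_apply, RCLike.inner_apply, conj_trivial, Fin.sum_univ_three, hgθ, hgΦ,
    hθL, fderiv_Phi_apply hy, PiLp.single_apply]
  simp only [Fin.isValue, ↓reduceIte, Fin.reduceEq]
  ring

set_option maxRecDepth 40000 in
set_option maxHeartbeats 1600000 in
set_option pp.maxSteps 2000000 in
set_option pp.deepTerms true in
/-- ★★★ **The linearised momentum identity for the explicit V♯ witness**, off the axis ray: `Dδv(x)(U x) + DU(x)(δv x) + ∇δp(x) = Δδv(x)` for Landau`s flow `U = landau2`. [folklore] -/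
theorem momentum_witness {x : E3} (hx : ‖x‖ ≠ x 2) :
    fderiv ℝ δvf x (landau2 x) + fderiv ℝ landau2 x (δvf x) + gradient δpf x = Laplacian.laplacian δvf x := by
  have hdiv : ∀ y : E3, ‖y‖ ≠ y 2 → VectorCalculus.divergence δvf y = 0 := fun y hy => divergence_witness hy
  obtain ⟨h0, h1, h2⟩ : x ≠ 0 ∧ ‖x‖ - x 2 ≠ 0 ∧ 2 * ‖x‖ - x 2 ≠ 0 := by
    have hle' : x 2 ≤ ‖x‖ := (le_abs_self _).trans (by simpa using PiLp.norm_apply_le x 2)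
    refine ⟨fun h => hx ?_, sub_ne_zero.2 hx, ?_⟩
    · rw [h]; simp
    · intro h
      have : ‖x‖ = 0 := by linarith [norm_nonneg x]
      rw [norm_eq_zero] at this
      apply hx; rw [this]; simp
  have hr0 : ‖x‖ ≠ 0 := norm_ne_zero_iff.2 h0
  have hM0 : (‖x‖ - x 2) ^ 2 * (2 * ‖x‖ - x 2) ≠ 0 := mul_ne_zero (pow_ne_zero 2 h1) h2
  rw [laplacian_witness hx hdiv]
  -- ### first-order atoms and chains at x (as in `laplacian_theta`)
  have hn : HasFDerivAt (fun y : E3 => ‖y‖) (‖x‖⁻¹ • (innerSL ℝ x : E3 →L[ℝ] ℝ)) x := hasFDerivAt_norm_of_ne_zero h0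
  have hp : ∀ i : Fin 3, HasFDerivAt (fun y : E3 => y i) (EuclideanSpace.proj i : E3 →L[ℝ] ℝ) x := fun i =>
    (EuclideanSpace.proj i : E3 →L[ℝ] ℝ).hasFDerivAt
  have hN : HasFDerivAt (fun y : E3 => 10 * ‖y‖ - 8 * y 2) _ x := (hn.const_mul 10).sub ((hp 2).const_mul 8)
  have hD1 : HasFDerivAt (fun y : E3 => ‖y‖ - y 2) _ x := hn.sub (hp 2)
  have hD2 : HasFDerivAt (fun y : E3 => 2 * ‖y‖ - y 2) _ x := (hn.const_mul 2).sub (hp 2)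
  have hD1sq : HasFDerivAt (fun y : E3 => (‖y‖ - y 2) ^ 2) _ x :=
    (hD1.mul hD1).congr_of_eventuallyEq (Filter.Eventually.of_forall fun y => (sq (‖y‖ - y 2)))
  have hD2sq : HasFDerivAt (fun y : E3 => (2 * ‖y‖ - y 2) ^ 2) _ x :=
    (hD2.mul hD2).congr_of_eventuallyEq (Filter.Eventually.of_forall fun y => (sq (2 * ‖y‖ - y 2)))
  have hD2cube : HasFDerivAt (fun y : E3 => (2 * ‖y‖ - y 2) ^ 3) _ x :=
    (hD2sq.mul hD2).congr_of_eventuallyEq (Filter.Eventually.of_forall fun y => (pow_succ (2 * ‖y‖ - y 2) 2))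
  have hM : HasFDerivAt (fun y : E3 => (‖y‖ - y 2) ^ 2 * (2 * ‖y‖ - y 2)) _ x := hD1sq.mul hD2
  have hMinv : HasFDerivAt (fun y : E3 => ((‖y‖ - y 2) ^ 2 * (2 * ‖y‖ - y 2))⁻¹) _ x :=
    (hasDerivAt_inv hM0).comp_hasFDerivAt x hM
  have hMsq : HasFDerivAt (fun y : E3 => ((‖y‖ - y 2) ^ 2 * (2 * ‖y‖ - y 2)) ^ 2) _ x :=
    (hM.mul hM).congr_of_eventuallyEq (Filter.Eventually.of_forall fun y => (sq _))
  have hM2inv : HasFDerivAt (fun y : E3 => (((‖y‖ - y 2) ^ 2 * (2 * ‖y‖ - y 2)) ^ 2)⁻¹) _ x :=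
    (hasDerivAt_inv (pow_ne_zero 2 hM0)).comp_hasFDerivAt x hMsq
  have hninv : HasFDerivAt (fun y : E3 => ‖y‖⁻¹) _ x := (hasDerivAt_inv hr0).comp_hasFDerivAt x hn
  have hnsq : HasFDerivAt (fun y : E3 => ‖y‖ ^ 2) _ x :=
    (hn.mul hn).congr_of_eventuallyEq (Filter.Eventually.of_forall fun y => (sq ‖y‖))
  have hnsqinv : HasFDerivAt (fun y : E3 => (‖y‖ ^ 2)⁻¹) _ x := (hasDerivAt_inv (pow_ne_zero 2 hr0)).comp_hasFDerivAt x hnsq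
  have hm2inv1 : HasFDerivAt (fun y : E3 => (2 * ‖y‖ - y 2)⁻¹) _ x := (hasDerivAt_inv h2).comp_hasFDerivAt x hD2
  have hm2inv2 : HasFDerivAt (fun y : E3 => ((2 * ‖y‖ - y 2) ^ 2)⁻¹) _ x :=
    (hasDerivAt_inv (pow_ne_zero 2 h2)).comp_hasFDerivAt x hD2sq
  have hm2inv3 : HasFDerivAt (fun y : E3 => ((2 * ‖y‖ - y 2) ^ 3)⁻¹) _ x :=
    (hasDerivAt_inv (pow_ne_zero 3 h2)).comp_hasFDerivAt x hD2cube
  have hQ : HasFDerivAt (fun y : E3 => y 0 ^ 2 - y 1 ^ 2) _ x :=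
    (((hp 0).mul (hp 0)).congr_of_eventuallyEq (Filter.Eventually.of_forall fun y => (sq (y 0)))).sub
      (((hp 1).mul (hp 1)).congr_of_eventuallyEq (Filter.Eventually.of_forall fun y => (sq (y 1))))
  have hAf : HasFDerivAt Afun _ x := hN.mul hMinv
  have halpha : HasFDerivAt alpha _ x :=
    (hMinv.const_mul 10).sub ((hN.mul hM2inv).mul ((hD1sq.const_mul 2).add ((hD2.mul hD1).const_mul 2)))
  have hbet : HasFDerivAt bet _ x :=
    (hMinv.const_mul (-8)).add ((hN.mul hM2inv).mul (hD1sq.add ((hD2.mul hD1).const_mul 2)))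
  have hc0 : HasFDerivAt c0 _ x := (hAf.const_mul 2).mul (hp 0)
  have hc1 : HasFDerivAt c1 _ x := ((hAf.const_mul 2).mul (hp 1)).neg
  have hc2' : HasFDerivAt c2 _ x := hQ.mul hbet
  have hc3 : HasFDerivAt c3 _ x := (hQ.mul halpha).mul hninv
  have hθ : HasFDerivAt θf _ x := (hQ.mul hN).mul hMinv
  have hg : HasFDerivAt gf _ x := (hθ.const_mul 6).mul hm2inv2
  have he0 : HasFDerivAt e0 _ x := (hc0.const_mul 6).mul hm2inv2
  have he1 : HasFDerivAt e1 _ x := (hc1.const_mul 6).mul hm2inv2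
  have he2 : HasFDerivAt e2 _ x := ((hc2'.const_mul 6).mul hm2inv2).add ((hθ.const_mul 12).mul hm2inv3)
  have hq2 : HasFDerivAt q2 _ x := hm2inv1.const_mul 2
  have hq3 : HasFDerivAt q3 _ x := (hnsqinv.const_mul 2).sub ((hninv.const_mul 4).mul hm2inv1)
  -- ### (M-a) curl w at x
  have hw : HasFDerivAt wf _ x :=
    ((((he1.mul (hp 2)).sub (he2.mul (hp 1))).smul_const (EuclideanSpace.single 0 1 : E3)).add
      (((he2.mul (hp 0)).sub (he0.mul (hp 2))).smul_const (EuclideanSpace.single 1 1 : E3))).add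
      (((he0.mul (hp 1)).sub (he1.mul (hp 0))).smul_const (EuclideanSpace.single 2 1 : E3))
  have hcw0 : curl wf x 0 = fderiv ℝ wf x (EuclideanSpace.single 1 1) 2 - fderiv ℝ wf x (EuclideanSpace.single 2 1) 1 := by
    simp [curl]
  have hcw1 : curl wf x 1 = fderiv ℝ wf x (EuclideanSpace.single 2 1) 0 - fderiv ℝ wf x (EuclideanSpace.single 0 1) 2 := by
    simp [curl]
  have hcw2 : curl wf x 2 = fderiv ℝ wf x (EuclideanSpace.single 0 1) 1 - fderiv ℝ wf x (EuclideanSpace.single 1 1) 0 := by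
    simp [curl]
  -- ### (M-b) the derivative of the witness at x
  have hθ2 : ContDiffAt ℝ 2 θf x := contDiffAt_thetaf hx
  have hD := differentiableAt_fderiv_of_contDiffAt hθ2
  have hG : DifferentiableAt ℝ (gradient θf) x := by
    have e : gradient θf = fun y => (InnerProductSpace.toDual ℝ E3).symm (fderiv ℝ θf y) := rfl
    rw [e]
    exact ((InnerProductSpace.toDual ℝ E3).symm.toContinuousLinearEquiv.contDiff.contDiffAt.comp x
      (hθ2.fderiv_right (m := 1) (by norm_num))).differentiableAt one_ne_zero
  have hδ : HasFDerivAt δvf _ x := hG.hasFDerivAt.add (hg.smul (hasFDerivAt_id x))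
  have hev : ∀ v : E3, (fun y => fderiv ℝ θf y v) =ᶠ[𝓝 x] (fun y => c0 y * v 0 + c1 y * v 1 + c2 y * v 2 + c3 y * ⟪v, y⟫) :=
    fun v => by
    filter_upwards [isOpen_offRay.mem_nhds hx] with y hy
    rw [show fderiv ℝ θf y = Lθ y from fderiv_theta_eq_L hy, Ltheta_apply]
  have hsum : ∀ v : E3, HasFDerivAt (fun y => c0 y * v 0 + c1 y * v 1 + c2 y * v 2 + c3 y * ⟪v, y⟫) _ x := fun v =>
    (((hc0.mul_const (v 0)).add (hc1.mul_const (v 1))).add (hc2'.mul_const (v 2))).add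
      (hc3.mul ((innerSL ℝ v : E3 →L[ℝ] ℝ).hasFDerivAt))
  have hGcomp : ∀ (i : Fin 3) (w : E3), fderiv ℝ (gradient θf) x w i =
      fderiv ℝ (fun y => c0 y * (EuclideanSpace.single i (1 : ℝ) : E3) 0 + c1 y * (EuclideanSpace.single i (1 : ℝ) : E3) 1 +
        c2 y * (EuclideanSpace.single i (1 : ℝ) : E3) 2 + c3 y * ⟪(EuclideanSpace.single i (1 : ℝ) : E3), y⟫) x w := by
    intro i w
    have h := ((EuclideanSpace.proj i : E3 →L[ℝ] ℝ).hasFDerivAt.comp x hG.hasFDerivAt).fderiv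
    have e : ((EuclideanSpace.proj i : E3 →L[ℝ] ℝ) ∘ gradient θf) = fun y => fderiv ℝ θf y (EuclideanSpace.single i 1) := by
      funext y
      simp only [Function.comp_apply]
      exact gradient_apply_eq_fderiv_single θf y i
    rw [e, (hev _).fderiv_eq] at h
    rw [h]
    rfl
  -- ### (M-d) the pressure gradient
  have hevp : δpf =ᶠ[𝓝 x] Fp := by
    filter_upwards [isOpen_offRay.mem_nhds hx] with y hy
    exact deltap_eq_Fp hy
  have hFp : HasFDerivAt Fp _ x :=
    hg.sub (((((hq3.mul (hp 0)).mul (hc0.add (hc3.mul (hp 0)))).add ((hq3.mul (hp 1)).mul (hc1.add (hc3.mul (hp 1))))).add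
      ((hq2.add (hq3.mul (hp 2))).mul (hc2'.add (hc3.mul (hp 2))))))
  have hgp : ∀ i : Fin 3, gradient δpf x i = fderiv ℝ Fp x (EuclideanSpace.single i 1) := by
    intro i
    rw [gradient_apply_eq_fderiv_single, hevp.fderiv_eq]
  -- ### (M-c) the base: U x, DU(x) h, and the witness value at x
  have hU : landau2 x = (2⁻¹ * landauAxisPressure (EuclideanSpace.single 2 1) 2 x) • x +
      (2 / (2 * ‖x‖ - ⟪(EuclideanSpace.single 2 1 : E3), x⟫)) • (EuclideanSpace.single 2 1 : E3) := by
    show landauAxisField (EuclideanSpace.single 2 1) 2 x = _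
    rw [landauAxisField_eq LandauBase.norm_e2 LandauBase.one_lt_abs_two]
  have hδv : ∀ i : Fin 3, δvf x i = (c0 x * (EuclideanSpace.single i (1 : ℝ) : E3) 0 + c1 x * (EuclideanSpace.single i (1 : ℝ) : E3) 1 +
      c2 x * (EuclideanSpace.single i (1 : ℝ) : E3) 2 + c3 x * ⟪(EuclideanSpace.single i (1 : ℝ) : E3), x⟫) + gf x * x i := by
    intro i
    have hθL : fderiv ℝ θf x = Lθ x := fderiv_theta_eq_L hx
    simp only [δvf, PiLp.add_apply, PiLp.smul_apply, smul_eq_mul, gradient_apply_eq_fderiv_single, hθL, Ltheta_apply]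
  -- assemble componentwise
  have ha2 : ⟪(EuclideanSpace.single 2 1 : E3), x⟫ = x 2 := by rw [EuclideanSpace.inner_single_left]; simp
  -- the base derivative applied to the witness value
  have hDU : fderiv ℝ landau2 x (δvf x) = (2⁻¹ * landauAxisPressure (EuclideanSpace.single 2 1) 2 x) • δvf x +
      (2⁻¹ * fderiv ℝ (landauAxisPressure (EuclideanSpace.single 2 1) 2) x (δvf x)) • x +
      (fderiv ℝ (fun y : E3 => 2 / (2 * ‖y‖ - ⟪(EuclideanSpace.single 2 1 : E3), y⟫)) x (δvf x)) •
        (EuclideanSpace.single 2 1 : E3) := by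
    show fderiv ℝ (landauAxisField (EuclideanSpace.single 2 1) 2) x (δvf x) = _
    rw [fderiv_landauAxisField_apply LandauBase.norm_e2 LandauBase.one_lt_abs_two h0]
  have hDP := LandauBase.fderiv_landauAxisPressure_apply LandauBase.norm_e2 LandauBase.one_lt_abs_two h0 (δvf x)
  have hDβ := fderiv_landauBeta_apply (a := (EuclideanSpace.single 2 1 : E3)) (c := (2 : ℝ)) LandauBase.norm_e2
    LandauBase.one_lt_abs_two h0 (δvf x)
  -- inner products at x
  have ha2 : ⟪(EuclideanSpace.single 2 1 : E3), x⟫ = x 2 := by rw [EuclideanSpace.inner_single_left]; simp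
  have hxδ : ⟪x, δvf x⟫ = x 0 * δvf x 0 + x 1 * δvf x 1 + x 2 * δvf x 2 := by
    simp only [PiLp.inner_apply, RCLike.inner_apply, conj_trivial, Fin.sum_univ_three]; ring
  have haδ : ⟪(EuclideanSpace.single 2 1 : E3), δvf x⟫ = δvf x 2 := by rw [EuclideanSpace.inner_single_left]; simp
  have hsδ : ⟪((2 : ℝ) * ‖x‖⁻¹) • x - (EuclideanSpace.single 2 1 : E3), δvf x⟫ =
      2 * ‖x‖⁻¹ * (x 0 * δvf x 0 + x 1 * δvf x 1 + x 2 * δvf x 2) - δvf x 2 := by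
    rw [inner_sub_left, inner_smul_left, hxδ, haδ]; simp
  have i0 : ⟪x, (EuclideanSpace.single 0 1 : E3)⟫ = x 0 := by rw [EuclideanSpace.inner_single_right]; simp
  have i1 : ⟪x, (EuclideanSpace.single 1 1 : E3)⟫ = x 1 := by rw [EuclideanSpace.inner_single_right]; simp
  have i2 : ⟪x, (EuclideanSpace.single 2 1 : E3)⟫ = x 2 := by rw [EuclideanSpace.inner_single_right]; simp
  have j0 : ⟪(EuclideanSpace.single 0 1 : E3), x⟫ = x 0 := by rw [EuclideanSpace.inner_single_left]; simp
  have j1 : ⟪(EuclideanSpace.single 1 1 : E3), x⟫ = x 1 := by rw [EuclideanSpace.inner_single_left]; simp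
  have s00 : ⟪(EuclideanSpace.single 0 1 : E3), (EuclideanSpace.single 0 1 : E3)⟫ = 1 := by
    rw [EuclideanSpace.inner_single_left]; simp
  have s11 : ⟪(EuclideanSpace.single 1 1 : E3), (EuclideanSpace.single 1 1 : E3)⟫ = 1 := by
    rw [EuclideanSpace.inner_single_left]; simp
  have s22 : ⟪(EuclideanSpace.single 2 1 : E3), (EuclideanSpace.single 2 1 : E3)⟫ = 1 := by
    rw [EuclideanSpace.inner_single_left]; simp
  have s01 : ⟪(EuclideanSpace.single 0 1 : E3), (EuclideanSpace.single 1 1 : E3)⟫ = 0 := by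
    rw [EuclideanSpace.inner_single_left]; simp
  have s02 : ⟪(EuclideanSpace.single 0 1 : E3), (EuclideanSpace.single 2 1 : E3)⟫ = 0 := by
    rw [EuclideanSpace.inner_single_left]; simp
  have s10 : ⟪(EuclideanSpace.single 1 1 : E3), (EuclideanSpace.single 0 1 : E3)⟫ = 0 := by
    rw [EuclideanSpace.inner_single_left]; simp
  have s12 : ⟪(EuclideanSpace.single 1 1 : E3), (EuclideanSpace.single 2 1 : E3)⟫ = 0 := by
    rw [EuclideanSpace.inner_single_left]; simp
  have s20 : ⟪(EuclideanSpace.single 2 1 : E3), (EuclideanSpace.single 0 1 : E3)⟫ = 0 := by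
    rw [EuclideanSpace.inner_single_left]; simp
  have s21 : ⟪(EuclideanSpace.single 2 1 : E3), (EuclideanSpace.single 1 1 : E3)⟫ = 0 := by
    rw [EuclideanSpace.inner_single_left]; simp
  have hpj : ∀ (i : Fin 3) (v : E3), (EuclideanSpace.proj i : E3 →L[ℝ] ℝ) v = v i := fun i v => rfl
  -- the witness value components at x, as plain algebra
  have hv0 := hδv 0
  have hv1 := hδv 1
  have hv2 := hδv 2
  simp only [PiLp.single_apply, Fin.isValue, ↓reduceIte, Fin.reduceEq, j0, j1, ha2, mul_one, mul_zero, add_zero,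
    zero_add] at hv0 hv1 hv2
  have hr2 : ‖x‖ ^ 2 = x 0 ^ 2 + x 1 ^ 2 + x 2 ^ 2 := by
    rw [EuclideanSpace.norm_eq, Real.sq_sqrt (by positivity), Fin.sum_univ_three]
    simp only [Real.norm_eq_abs, sq_abs]
  have hG0 : ∀ w : E3, fderiv ℝ (gradient θf) x w 0 = _ := fun w =>
    (hGcomp 0 w).trans (congrArg (fun L : E3 →L[ℝ] ℝ => L w) (hsum (EuclideanSpace.single 0 1)).fderiv)
  have hG1 : ∀ w : E3, fderiv ℝ (gradient θf) x w 1 = _ := fun w =>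
    (hGcomp 1 w).trans (congrArg (fun L : E3 →L[ℝ] ℝ => L w) (hsum (EuclideanSpace.single 1 1)).fderiv)
  have hG2 : ∀ w : E3, fderiv ℝ (gradient θf) x w 2 = _ := fun w =>
    (hGcomp 2 w).trans (congrArg (fun L : E3 →L[ℝ] ℝ => L w) (hsum (EuclideanSpace.single 2 1)).fderiv)
  have hxx : ⟪x, x⟫ = ‖x‖ ^ 2 := real_inner_self_eq_norm_sq x
  ext i
  rw [PiLp.add_apply, PiLp.add_apply, PiLp.neg_apply, hgp i, hFp.fderiv, hDU, hδ.fderiv]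
  fin_cases i
  · simp only [Fin.zero_eta, Fin.isValue, add_apply, smul_apply, PiLp.add_apply, PiLp.smul_apply, smul_eq_mul,
      ContinuousLinearMap.smulRight_apply, ContinuousLinearMap.id_apply, hG0, hcw0, hw.fderiv, hDP, hDβ,
      sub_apply, neg_apply, innerSL_apply_apply, hpj, hsδ, hxδ, haδ, hU, inner_add_right, inner_smul_right, hxx, ha2, i0, i1, i2,
      j0, s02, PiLp.single_apply, Pi.mul_apply, Pi.add_apply,
       ]
    simp only [Fin.isValue, ↓reduceIte, Fin.reduceEq, mul_one, mul_zero, add_zero, zero_add, sub_zero, hv0, hv1, hv2]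
    simp only [c0, c1, c2, c3, e0, q2, q3, gf, θf, Afun, alpha, bet, landauAxisPressure, ha2]
    clear hc0 hc1 hc2' hc3 hsum hAf halpha hbet hQ hM2inv hMsq hMinv hM hD1sq hD1 hD2 hN hninv hev hD hθ2 hp hpj hn hG hδ hg hθ
      he0 he1 he2 hq2 hq3 hw hFp hevp hgp hGcomp hG0 hG1 hG2 hcw0 hcw1 hcw2 hDU hDP hDβ hxδ haδ hsδ hv0 hv1 hv2 hδv hU hD2sq
      hD2cube hnsq hnsqinv hm2inv1 hm2inv2 hm2inv3 i0 i1 i2 j0 j1 s00 s11 s22 s01 s02 s10 s12 s20 s21 hdiv hxx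
    set r := ‖x‖ with hrdef
    set a := x 0 with hadef
    set b := x 1 with hbdef
    set c := x 2 with hcdef
    have h2' : r * 2 - c ≠ 0 := fun h => h2 (by linarith)
    field_simp
    linear_combination (-264 * a ^ 3 * c ^ 7 + 3280 * a ^ 3 * c ^ 6 * r - 16136 * a ^ 3 * c ^ 5 * r ^ 2 + 39536 * a ^ 3 * c ^ 4 * r ^ 3 - 52320 * a ^ 3 * c ^ 3 * r ^ 4 + 36544 * a ^ 3 * c ^ 2 * r ^ 5 - 11008 * a ^ 3 * c * r ^ 6 + 320 * a ^ 3 * r ^ 7 + 264 * a * b ^ 2 * c ^ 7 - 3280 * a * b ^ 2 * c ^ 6 * r + 16136 * a * b ^ 2 * c ^ 5 * r ^ 2 - 39536 * a * b ^ 2 * c ^ 4 * r ^ 3 + 52320 * a * b ^ 2 * c ^ 3 * r ^ 4 - 36544 * a * b ^ 2 * c ^ 2 * r ^ 5 + 11008 * a * b ^ 2 * c * r ^ 6 - 320 * a * b ^ 2 * r ^ 7 + 176 * a * c ^ 7 * r ^ 2 - 1696 * a * c ^ 6 * r ^ 3 + 5440 * a * c ^ 5 * r ^ 4 - 4512 *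 a * c ^ 4 * r ^ 5 - 11440 * a * c ^ 3 * r ^ 6 + 29632 * a * c ^ 2 * r ^ 7 - 25280 * a * c * r ^ 8 + 7680 * a * r ^ 9) * hr2
  · simp only [Fin.mk_one, Fin.isValue, add_apply, smul_apply, PiLp.add_apply, PiLp.smul_apply, smul_eq_mul,
      ContinuousLinearMap.smulRight_apply, ContinuousLinearMap.id_apply, hG1, hcw1, hw.fderiv, hDP, hDβ,
      sub_apply, neg_apply, innerSL_apply_apply, hpj, hsδ, hxδ, haδ, hU, inner_add_right, inner_smul_right, hxx, ha2, i0, i1, i2,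
      j1, s12, PiLp.single_apply, Pi.mul_apply, Pi.add_apply,
       ]
    simp only [Fin.isValue, ↓reduceIte, Fin.reduceEq, mul_one, mul_zero, add_zero, zero_add, sub_zero, hv0, hv1, hv2]
    simp only [c0, c1, c2, c3, e1, q2, q3, gf, θf, Afun, alpha, bet, landauAxisPressure, ha2]
    clear hc0 hc1 hc2' hc3 hsum hAf halpha hbet hQ hM2inv hMsq hMinv hM hD1sq hD1 hD2 hN hninv hev hD hθ2 hp hpj hn hG hδ hg hθ
      he0 he1 he2 hq2 hq3 hw hFp hevp hgp hGcomp hG0 hG1 hG2 hcw0 hcw1 hcw2 hDU hDP hDβ hxδ haδ hsδ hv0 hv1 hv2 hδv hU hD2sq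
      hD2cube hnsq hnsqinv hm2inv1 hm2inv2 hm2inv3 i0 i1 i2 j0 j1 s00 s11 s22 s01 s02 s10 s12 s20 s21 hdiv hxx
    set r := ‖x‖ with hrdef
    set a := x 0 with hadef
    set b := x 1 with hbdef
    set c := x 2 with hcdef
    have h2' : r * 2 - c ≠ 0 := fun h => h2 (by linarith)
    field_simp
    linear_combination (-264 * a ^ 2 * b * c ^ 7 + 3280 * a ^ 2 * b * c ^ 6 * r - 16136 * a ^ 2 * b * c ^ 5 * r ^ 2 + 39536 * a ^ 2 * b * c ^ 4 * r ^ 3 - 52320 * a ^ 2 * b * c ^ 3 * r ^ 4 + 36544 * a ^ 2 * b * c ^ 2 * r ^ 5 - 11008 * a ^ 2 * b * c * r ^ 6 + 320 * a ^ 2 * b * r ^ 7 + 264 * b ^ 3 * c ^ 7 - 3280 * b ^ 3 * c ^ 6 * r + 16136 * b ^ 3 * c ^ 5 * r ^ 2 - 39536 * b ^ 3 * c ^ 4 * r ^ 3 + 52320 * b ^ 3 * c ^ 3 * r ^ 4 - 36544 * b ^ 3 * c ^ 2 * r ^ 5 + 11008 * b ^ 3 * c * r ^ 6 - 320 * b ^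 3 * r ^ 7 - 176 * b * c ^ 7 * r ^ 2 + 1696 * b * c ^ 6 * r ^ 3 - 5440 * b * c ^ 5 * r ^ 4 + 4512 * b * c ^ 4 * r ^ 5 + 11440 * b * c ^ 3 * r ^ 6 - 29632 * b * c ^ 2 * r ^ 7 + 25280 * b * c * r ^ 8 - 7680 * b * r ^ 9) * hr2
  · simp only [Fin.reduceFinMk, Fin.isValue, add_apply, smul_apply, PiLp.add_apply, PiLp.smul_apply, smul_eq_mul,
      ContinuousLinearMap.smulRight_apply, ContinuousLinearMap.id_apply, hG2, hcw2, hw.fderiv, hDP, hDβ,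
      sub_apply, neg_apply, innerSL_apply_apply, hpj, hsδ, hxδ, haδ, hU, inner_add_right, inner_smul_right, hxx, ha2, i0, i1, i2,
      s22, PiLp.single_apply, Pi.mul_apply, Pi.add_apply,
       ]
    simp only [Fin.isValue, ↓reduceIte, Fin.reduceEq, mul_one, mul_zero, add_zero, zero_add, sub_zero, hv0, hv1, hv2]
    simp only [c0, c1, c2, c3, e2, q2, q3, gf, θf, Afun, alpha, bet, landauAxisPressure, ha2]
    clear hc0 hc1 hc2' hc3 hsum hAf halpha hbet hQ hM2inv hMsq hMinv hM hD1sq hD1 hD2 hN hninv hev hD hθ2 hp hpj hn hG hδ hg hθ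
      he0 he1 he2 hq2 hq3 hw hFp hevp hgp hGcomp hG0 hG1 hG2 hcw0 hcw1 hcw2 hDU hDP hDβ hxδ haδ hsδ hv0 hv1 hv2 hδv hU hD2sq
      hD2cube hnsq hnsqinv hm2inv1 hm2inv2 hm2inv3 i0 i1 i2 j0 j1 s00 s11 s22 s01 s02 s10 s12 s20 s21 hdiv hxx
    set r := ‖x‖ with hrdef
    set a := x 0 with hadef
    set b := x 1 with hbdef
    set c := x 2 with hcdef
    have h2' : r * 2 - c ≠ 0 := fun h => h2 (by linarith)
    field_simp
    linear_combination (-264 * a ^ 2 * c ^ 8 + 3280 * a ^ 2 * c ^ 7 * r - 16400 * a ^ 2 * c ^ 6 * r ^ 2 + 41696 * a ^ 2 * c ^ 5 * r ^ 3 - 55776 * a ^ 2 * c ^ 4 * r ^ 4 + 27760 * a ^ 2 * c ^ 3 * r ^ 5 + 22088 * a ^ 2 * c ^ 2 * r ^ 6 - 36160 * a ^ 2 * c * r ^ 7 + 13920 * a ^ 2 * r ^ 8 + 264 * b ^ 2 * c ^ 8 - 3280 * b ^ 2 * c ^ 7 * r + 16400 * b ^ 2 * c ^ 6 * r ^ 2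 - 41696 * b ^ 2 * c ^ 5 * r ^ 3 + 55776 * b ^ 2 * c ^ 4 * r ^ 4 - 27760 * b ^ 2 * c ^ 3 * r ^ 5 - 22088 * b ^ 2 * c ^ 2 * r ^ 6 + 36160 * b ^ 2 * c * r ^ 7 - 13920 * b ^ 2 * r ^ 8) * hr2


end VertexWitness

end Summit.NavierStokesRegularity.NavierStokesRegularity.Theorems.PoloidalLiouville.AzimuthalCartan
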